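import Mathlib
import Summits.Ventures.HodgeRepro0.P6HubBarrierBezout

/-!
# P6HubBarrierLocal — polynomial identities behind Lemma 1.2 (iii) of proofs/P6-K3HubBarrier-v1.3.md (D9), and the
cyclotomic polynomials / Bezout constants for orders 5 and 10 (P6-K3Order5Classes-v1.3 §4, NOT part of D9)

* `Φ₁₂ = (X² + 1)² − 3 X²` and `Φ₈ = (X² + 1)² − 2 X²` in `ℤ[X]`;
* in any commutative ring `(x² − r x + 1)(x² + r x + 1) = (x² + 1)² − r² x²`, so `r² = 3` (resp. `2`) factors
  `x⁴ − x² + 1` (resp. `x⁴ + 1`) as `(x² − r x + 1)(x² + r x + 1)`;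
* with `r² = 3`, `i² = −1`, `2h = 1`: `z := (r + i) h` satisfies `z² − r z + 1 = 0`, `z³ = i`, `(2z − r)² = −1`;
  with `r² = 2`: `z := r (1 + i) h` satisfies `z² − r z + 1 = 0`, `z² = i`;
* `Φ₅ = X⁴ + X³ + X² + X + 1`, `Φ₁₀ = X⁴ − X³ + X² − X + 1`, `Φ₅ − (X − 1)(X³ + 2X² + 3X + 4) = 5`,
  `Φ₁₀ − (X + 1)(X³ − 2X² + 3X − 4) = 5`, `Φ₁₀ − (X − 1)(X³ + X) = 1`.
Supporting artefact only (R-5): finite algebra, never the discharge of a Hodge-theoretic step.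
-/

open Polynomial

namespace HodgeRepro0.P6HubBarrier

/-- `Φ₁₂ = (X² + 1)² − 3 X²`. -/
theorem cyclotomic_twelve_factor_shape : cyclotomic 12 ℤ = (X ^ 2 + 1) ^ 2 - 3 * X ^ 2 := by
  rw [cyclotomic_twelve_int]; ring

/-- `Φ₈ = (X² + 1)² − 2 X²`. -/
theorem cyclotomic_eight_factor_shape : cyclotomic 8 ℤ = (X ^ 2 + 1) ^ 2 - 2 * X ^ 2 := by
  rw [cyclotomic_eight_int]; ring

/-- The factorisation pattern of Lemma 1.2 (iii), in any commutative ring. -/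
theorem quartic_factor {R : Type*} [CommRing R] (r x : R) :
    (x ^ 2 - r * x + 1) * (x ^ 2 + r * x + 1) = (x ^ 2 + 1) ^ 2 - r ^ 2 * x ^ 2 := by ring

/-- With `r² = 3`: `(x² − r x + 1)(x² + r x + 1) = x⁴ − x² + 1`. -/
theorem quartic_factor_three {R : Type*} [CommRing R] (r x : R) (hr : r ^ 2 = 3) :
    (x ^ 2 - r * x + 1) * (x ^ 2 + r * x + 1) = x ^ 4 - x ^ 2 + 1 := by
  rw [quartic_factor, hr]; ring

/-- With `r² = 2`: `(x² − r x + 1)(x² + r x + 1) = x⁴ + 1`. -/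
theorem quartic_factor_two {R : Type*} [CommRing R] (r x : R) (hr : r ^ 2 = 2) :
    (x ^ 2 - r * x + 1) * (x ^ 2 + r * x + 1) = x ^ 4 + 1 := by
  rw [quartic_factor, hr]; ring

/-- `z = (r + i) h`, `r² = 3`, `i² = −1`, `2h = 1`: `z² − r z + 1 = 0`. -/
theorem root_twelve {R : Type*} [CommRing R] (r i h : R) (hr : r ^ 2 = 3) (hi : i ^ 2 = -1)
    (hh : 2 * h = 1) : ((r + i) * h) ^ 2 - r * ((r + i) * h) + 1 = 0 := by
  linear_combination (h ^ 2 - h) * hr + h ^ 2 * hi + ((1 + r * i) * h - 1) * hh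

/-- `z = (r + i) h`, `r² = 3`, `i² = −1`, `2h = 1`: `z³ = i`. -/
theorem root_twelve_cube {R : Type*} [CommRing R] (r i h : R) (hr : r ^ 2 = 3) (hi : i ^ 2 = -1)
    (hh : 2 * h = 1) : ((r + i) * h) ^ 3 = i := by
  linear_combination h ^ 3 * (r + 3 * i) * hr + h ^ 3 * (3 * r + i) * hi + i * (4 * h ^ 2 + 2 * h + 1) * hh

/-- `z = (r + i) h`, `i² = −1`, `2h = 1`: `(2z − r)² = −1` (the inverse map `i ↦ 2z − r`). -/
theorem root_twelve_inverse {R : Type*} [CommRing R] (r i h : R) (hi : i ^ 2 = -1) (hh : 2 * h = 1) :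
    (2 * ((r + i) * h) - r) ^ 2 = -1 := by
  linear_combination hi + (r + i) * (2 * i + (r + i) * (2 * h - 1)) * hh

/-- `z = r (1 + i) h`, `r² = 2`, `i² = −1`, `2h = 1`: `z² − r z + 1 = 0`. -/
theorem root_eight {R : Type*} [CommRing R] (r i h : R) (hr : r ^ 2 = 2) (hi : i ^ 2 = -1)
    (hh : 2 * h = 1) : (r * (1 + i) * h) ^ 2 - r * (r * (1 + i) * h) + 1 = 0 := by
  linear_combination ((1 + i) ^ 2 * h ^ 2 - (1 + i) * h) * hr + 2 * h ^ 2 * hi + (2 * i * h - 1) * hh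

/-- `z = r (1 + i) h`, `r² = 2`, `i² = −1`, `2h = 1`: `z² = i`. -/
theorem root_eight_square {R : Type*} [CommRing R] (r i h : R) (hr : r ^ 2 = 2) (hi : i ^ 2 = -1)
    (hh : 2 * h = 1) : (r * (1 + i) * h) ^ 2 = i := by
  linear_combination (1 + i) ^ 2 * h ^ 2 * hr + 2 * h ^ 2 * hi + i * (2 * h + 1) * hh

/-- `Φ₅ = X⁴ + X³ + X² + X + 1`. -/
theorem cyclotomic_five_int : cyclotomic 5 ℤ = X ^ 4 + X ^ 3 + X ^ 2 + X + 1 := by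
  haveI : Fact (Nat.Prime 5) := ⟨by norm_num⟩
  rw [cyclotomic_prime]
  simp [Finset.sum_range_succ]
  ring

/-- `Φ₁₀ = X⁴ − X³ + X² − X + 1` (`Φ₅(X²) = Φ₁₀ · Φ₅`, cancel `Φ₅`). -/
theorem cyclotomic_ten_int : cyclotomic 10 ℤ = X ^ 4 - X ^ 3 + X ^ 2 - X + 1 := by
  have h := cyclotomic_expand_eq_cyclotomic_mul (p := 2) (n := 5) Nat.prime_two (by norm_num) ℤ
  rw [show (5 : ℕ) * 2 = 10 from rfl, cyclotomic_five_int] at h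
  have h2 : expand ℤ 2 (X ^ 4 + X ^ 3 + X ^ 2 + X + 1 : ℤ[X]) =
      (X ^ 4 - X ^ 3 + X ^ 2 - X + 1) * (X ^ 4 + X ^ 3 + X ^ 2 + X + 1) := by
    simp [expand_X]
    ring
  have h3 : (X ^ 4 + X ^ 3 + X ^ 2 + X + 1 : ℤ[X]) ≠ 0 := by
    intro hc
    have := congrArg (fun q : ℤ[X] => q.eval 0) hc
    simp at this
  exact (mul_right_cancel₀ h3 (h2.symm.trans h)).symm

/-- `Φ₅ − (X − 1)(X³ + 2X² + 3X + 4) = 5`. -/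
theorem bezout_5_1 : cyclotomic 5 ℤ - cyclotomic 1 ℤ * (X ^ 3 + 2 * X ^ 2 + 3 * X + 4) = 5 := by
  rw [cyclotomic_five_int, cyclotomic_one]; ring

/-- `Φ₁₀ − (X + 1)(X³ − 2X² + 3X − 4) = 5`. -/
theorem bezout_10_2 : cyclotomic 10 ℤ - cyclotomic 2 ℤ * (X ^ 3 - 2 * X ^ 2 + 3 * X - 4) = 5 := by
  rw [cyclotomic_ten_int, cyclotomic_two]; ring

/-- `Φ₁₀ − (X − 1)(X³ + X) = 1`. -/
theorem bezout_10_1 : cyclotomic 10 ℤ - cyclotomic 1 ℤ * (X ^ 3 + X) = 1 := by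
  rw [cyclotomic_ten_int, cyclotomic_one]; ring

end HodgeRepro0.P6HubBarrier
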